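import Summits.ValiantsHypothesis.ValiantsHypothesis.Theorems.SymPencilPerFourPairingDiscTools
import Summits.ValiantsHypothesis.ValiantsHypothesis.Theorems.SymPencilPerFourHessianMinors

/-!
# Route `SymPencil` — the pairing discriminant on a six-dimensional two-row space, NORMALISED
# ONTO CASE: if `α` is onto and `e_{β₂}, e_{β₃} ∈ V'` then `β₀ ≡ β₁ ≡ 0`
# (towards leaf 5 `stub_twoLineFilter`; `--supports` stmt-ValiantsHypothesis-5674
# `SdcSuperquadratic`; rung currency only, nothing here bears on `VP ≠ VNP`)

Coordinates on `K⁸ = K^{Fin 4 ⊕ Fin 4}`: `α_i = Y (inl i)`, `β_i = Y (inr i)`; `A·B - 4Π` is the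
pairing discriminant (`SymPencilPerFourPairingDiscTools`).

* `disc_smul_inl`: `A·B - 4Π` is homogeneous of degree `4` in `α`.
* `disc_vanish_of_section` (the TOP COEFFICIENT): if `Y = (α;β) ∈ V'` and `(0;b) ∈ V'` and
  `A·B = 4Π` on `V'`, then `A·B = 4Π` at `(α; b)` — scale `u•Y + (0;b) ∈ V'` by the homogeneity to
  `(α; b + u β)`, `u ≠ 0`, and let `u → 0` along the line (`eval_zero_of_forall_ne_zero`).
* `inr_zero_one_vanish` (NORMALISED ONTO CASE): if `A·B = 4Π` on `V'`, every `α ∈ K⁴` is the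
  `α`-part of some `Y ∈ V'`, and the unit vectors `e_{β₂}, e_{β₃}` lie in `V'`, then
  `β₀ = β₁ = 0` on `V'`.  Proof: along `Y + s(e_{β₂}+e_{β₃})` the discriminant is a cubic in `s`
  with top coefficient `α₀α₁(α₂+α₃)·q`, `q = α₀β₁ + α₁β₀` (third finite difference), so `q ≡ 0`
  (`SymPencilPerFourHessianMinors.forall_eq_zero_or_of_mul₃`; the `α`-factors do not vanish
  identically since `α` is onto); along `Y + s e_{β₂}` it is a quadratic with top coefficient
  `α₀α₁α₃(α₃β₀β₁ + β₃ q)` (second difference), so `α₀α₁α₃²β₀β₁ ≡ 0`, a product of coordinate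
  functionals, whence `β₀ ≡ 0` or `β₁ ≡ 0`
  (`SymPencilPerFourPairingHyperplane.exists_forall_eq_zero_of_prod_eq_zero`), and `q ≡ 0` gives
  the other.

Honest framing: lemmas; `27 ≤ sdc(per₄) ≤ 29` unchanged, stmt-5674 open, `VP ≠ VNP` not moved, no
summit statement is proved here.  No definitions, no named facts. [folklore]
-/

noncomputable section

-- single-conjunct layout: Sub = Summit, duplicated namespace component intended
set_option linter.dupNamespace false

namespace Summit.ValiantsHypothesis.ValiantsHypothesis.Theorems.SymPencilPerFourPairingDiscSixNormal

open Matrix Finset Module Polynomial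
open Summit.ValiantsHypothesis.ValiantsHypothesis.Theorems.SymPencilPerFourPairingHyperplane
open Summit.ValiantsHypothesis.ValiantsHypothesis.Theorems.SymPencilPerFourPairingDiscTools
open Summit.ValiantsHypothesis.ValiantsHypothesis.Theorems.SymPencilPerFourHessianMinors

variable {K : Type*} [Field K]

/-! ### Homogeneity in `α` and the top coefficient -/

/-- **`A·B - 4Π` is homogeneous of degree `4` in `α`.** [folklore] -/
theorem disc_smul_inl (Y Z : Fin 4 ⊕ Fin 4 → K) (u : K)
    (hl : ∀ i, Y (Sum.inl i) = u * Z (Sum.inl i)) (hr : ∀ i, Y (Sum.inr i) = Z (Sum.inr i)) :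
    (∑ j, ∏ i, if i = j then Y (Sum.inl i) else Y (Sum.inr i)) *
        (∑ j, ∏ i, if i = j then Y (Sum.inr i) else Y (Sum.inl i)) -
        4 * ∏ i, Y (Sum.inl i) * Y (Sum.inr i) =
      u ^ 4 * ((∑ j, ∏ i, if i = j then Z (Sum.inl i) else Z (Sum.inr i)) *
        (∑ j, ∏ i, if i = j then Z (Sum.inr i) else Z (Sum.inl i)) -
        4 * ∏ i, Z (Sum.inl i) * Z (Sum.inr i)) := by
  rw [sumA_four, sumA_four, sumA_four, sumA_four, prodAB_four, prodAB_four]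
  simp only [hl, hr]
  ring

/-- **The top coefficient**: if `A·B = 4Π` on `V'`, `Y ∈ V'` and `(0; b) ∈ V'` (`k` with
`k (inl i) = 0`, `k (inr i) = b_i`), then `A·B = 4Π` at `(α(Y); b)` (infinite field).
[folklore] -/
theorem disc_vanish_of_section [Infinite K] (V' : Submodule K (Fin 4 ⊕ Fin 4 → K))
    (hdisc : ∀ Y ∈ V',
      (∑ j, ∏ i, if i = j then Y (Sum.inl i) else Y (Sum.inr i)) *
        (∑ j, ∏ i, if i = j then Y (Sum.inr i) else Y (Sum.inl i)) =
        4 * ∏ i, Y (Sum.inl i) * Y (Sum.inr i))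
    {Y k : Fin 4 ⊕ Fin 4 → K} (hY : Y ∈ V') (hk : k ∈ V') (hk0 : ∀ i, k (Sum.inl i) = 0) :
    (∑ j, ∏ i, if i = j then Y (Sum.inl i) else k (Sum.inr i)) *
        (∑ j, ∏ i, if i = j then k (Sum.inr i) else Y (Sum.inl i)) =
        4 * ∏ i, Y (Sum.inl i) * k (Sum.inr i) := by
  classical
  -- the line `Z(u) = (α; b + u β)` in `K⁸`
  set Z₀ : Fin 4 ⊕ Fin 4 → K := fun c => Sum.elim (fun i => Y (Sum.inl i)) (fun i => k (Sum.inr i)) c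
    with hZ₀
  set Z₁ : Fin 4 ⊕ Fin 4 → K := fun c => Sum.elim (fun _ => (0 : K)) (fun i => Y (Sum.inr i)) c
    with hZ₁
  have hZl : ∀ (u : K) (i : Fin 4), (Z₀ + u • Z₁) (Sum.inl i) = Y (Sum.inl i) := fun u i => by
    simp [hZ₀, hZ₁, Pi.add_apply, Pi.smul_apply]
  have hZr : ∀ (u : K) (i : Fin 4), (Z₀ + u • Z₁) (Sum.inr i) = k (Sum.inr i) + u * Y (Sum.inr i) :=
    fun u i => by
    simp [hZ₀, hZ₁, Pi.add_apply, Pi.smul_apply]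
  -- the discriminant vanishes on the line off `u = 0`
  have hoff : ∀ u : K, u ≠ 0 →
      (fun Z : Fin 4 ⊕ Fin 4 → K =>
        (∑ j, ∏ i, if i = j then Z (Sum.inl i) else Z (Sum.inr i)) *
          (∑ j, ∏ i, if i = j then Z (Sum.inr i) else Z (Sum.inl i)) -
          4 * ∏ i, Z (Sum.inl i) * Z (Sum.inr i)) (Z₀ + u • Z₁) = 0 := by
    intro u hu
    have hmem : u • Y + k ∈ V' := V'.add_mem (V'.smul_mem u hY) hk
    have hW := hdisc _ hmem
    have hscale := disc_smul_inl (u • Y + k) (Z₀ + u • Z₁) u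
      (fun i => by rw [hZl]; simp [hk0 i])
      (fun i => by rw [hZr]; simp [Pi.add_apply, Pi.smul_apply]; ring)
    rw [sub_eq_zero.2 hW] at hscale
    have h4 : u ^ 4 ≠ 0 := pow_ne_zero 4 hu
    have := (mul_eq_zero.1 hscale.symm).resolve_left h4
    simpa using this
  have h0 := eval_zero_of_forall_ne_zero (M := Fin 4 ⊕ Fin 4 → K)
    (f := fun Z : Fin 4 ⊕ Fin 4 → K =>
      (∑ j, ∏ i, if i = j then Z (Sum.inl i) else Z (Sum.inr i)) *
        (∑ j, ∏ i, if i = j then Z (Sum.inr i) else Z (Sum.inl i)) -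
        4 * ∏ i, Z (Sum.inl i) * Z (Sum.inr i)) (y₀ := Z₀) (y := Z₁) (linePoly_disc Z₀ Z₁) hoff
  -- read off at `u = 0`
  simp only [hZ₀, Sum.elim_inl, Sum.elim_inr] at h0
  exact sub_eq_zero.1 h0

/-! ### The normalised onto case -/

/-- The quadratic `q = α₀β₁ + α₁β₀` is polynomial along lines. [folklore] -/
theorem linePoly_q (y₀ y : Fin 4 ⊕ Fin 4 → K) :
    ∃ p : K[X], ∀ t : K,
      (fun Z : Fin 4 ⊕ Fin 4 → K => Z (Sum.inl 0) * Z (Sum.inr 1) + Z (Sum.inl 1) * Z (Sum.inr 0))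
        (y₀ + t • y) = p.eval t := by
  refine ⟨Polynomial.C (y₀ (Sum.inl 0) * y₀ (Sum.inr 1) + y₀ (Sum.inl 1) * y₀ (Sum.inr 0)) +
      Polynomial.C (y₀ (Sum.inl 0) * y (Sum.inr 1) + y (Sum.inl 0) * y₀ (Sum.inr 1) +
        y₀ (Sum.inl 1) * y (Sum.inr 0) + y (Sum.inl 1) * y₀ (Sum.inr 0)) * Polynomial.X +
      Polynomial.C (y (Sum.inl 0) * y (Sum.inr 1) + y (Sum.inl 1) * y (Sum.inr 0)) *
        Polynomial.X ^ 2, fun t => ?_⟩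
  simp only [Pi.add_apply, Pi.smul_apply, smul_eq_mul, Polynomial.eval_add, Polynomial.eval_mul,
    Polynomial.eval_C, Polynomial.eval_X, Polynomial.eval_pow]
  ring

/-- The product `α₀ α₁` is polynomial along lines. [folklore] -/
theorem linePoly_a01 (y₀ y : Fin 4 ⊕ Fin 4 → K) :
    ∃ p : K[X], ∀ t : K,
      (fun Z : Fin 4 ⊕ Fin 4 → K => Z (Sum.inl 0) * Z (Sum.inl 1)) (y₀ + t • y) = p.eval t :=
  linePoly_mul (f := fun Z : Fin 4 ⊕ Fin 4 → K => Z (Sum.inl 0))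
    (g := fun Z : Fin 4 ⊕ Fin 4 → K => Z (Sum.inl 1))
    (linePoly_linear (LinearMap.proj (Sum.inl 0) : (Fin 4 ⊕ Fin 4 → K) →ₗ[K] K))
    (linePoly_linear (LinearMap.proj (Sum.inl 1) : (Fin 4 ⊕ Fin 4 → K) →ₗ[K] K)) y₀ y

/-- The sum `α₂ + α₃` is polynomial along lines. [folklore] -/
theorem linePoly_a23 (y₀ y : Fin 4 ⊕ Fin 4 → K) :
    ∃ p : K[X], ∀ t : K,
      (fun Z : Fin 4 ⊕ Fin 4 → K => Z (Sum.inl 2) + Z (Sum.inl 3)) (y₀ + t • y) = p.eval t :=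
  linePoly_linear ((LinearMap.proj (Sum.inl 2) : (Fin 4 ⊕ Fin 4 → K) →ₗ[K] K) +
    (LinearMap.proj (Sum.inl 3) : (Fin 4 ⊕ Fin 4 → K) →ₗ[K] K)) y₀ y

/-- **NORMALISED ONTO CASE.**  See the module docstring. [folklore] -/
theorem inr_zero_one_vanish [CharZero K] (V' : Submodule K (Fin 4 ⊕ Fin 4 → K))
    (hdisc : ∀ Y ∈ V',
      (∑ j, ∏ i, if i = j then Y (Sum.inl i) else Y (Sum.inr i)) *
        (∑ j, ∏ i, if i = j then Y (Sum.inr i) else Y (Sum.inl i)) =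
        4 * ∏ i, Y (Sum.inl i) * Y (Sum.inr i))
    (honto : ∀ α : Fin 4 → K, ∃ Y ∈ V', ∀ i, Y (Sum.inl i) = α i)
    (h2 : (Pi.single (Sum.inr 2) 1 : Fin 4 ⊕ Fin 4 → K) ∈ V')
    (h3 : (Pi.single (Sum.inr 3) 1 : Fin 4 ⊕ Fin 4 → K) ∈ V') :
    ∀ Y ∈ V', Y (Sum.inr 0) = 0 ∧ Y (Sum.inr 1) = 0 := by
  classical
  -- a vector of `V'` with `α = 𝟙`
  obtain ⟨Y₁, hY₁, hY₁a⟩ := honto fun _ => 1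
  -- (a) the cubic along `e_{β₂} + e_{β₃}`: `α₀α₁(α₂+α₃) q ≡ 0`
  have hcubic : ∀ Y ∈ V', (Y (Sum.inl 0) * Y (Sum.inr 1) + Y (Sum.inl 1) * Y (Sum.inr 0)) *
      (Y (Sum.inl 0) * Y (Sum.inl 1)) * (Y (Sum.inl 2) + Y (Sum.inl 3)) = 0 := by
    intro Y hY
    set v : Fin 4 ⊕ Fin 4 → K := Pi.single (Sum.inr 2) 1 + Pi.single (Sum.inr 3) 1 with hv
    have hvV : v ∈ V' := V'.add_mem h2 h3
    have hm : ∀ s : K, Y + s • v ∈ V' := fun s => V'.add_mem hY (V'.smul_mem s hvV)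
    have ev : ∀ s : K, (∀ i, (Y + s • v) (Sum.inl i) = Y (Sum.inl i)) ∧
        (Y + s • v) (Sum.inr 0) = Y (Sum.inr 0) ∧ (Y + s • v) (Sum.inr 1) = Y (Sum.inr 1) ∧
        (Y + s • v) (Sum.inr 2) = Y (Sum.inr 2) + s ∧ (Y + s • v) (Sum.inr 3) = Y (Sum.inr 3) + s := by
      intro s
      refine ⟨fun i => ?_, ?_, ?_, ?_, ?_⟩ <;> simp [hv]
    have P : ∀ s : K,
        (∑ j, ∏ i, if i = j then (Y + s • v) (Sum.inl i) else (Y + s • v) (Sum.inr i)) *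
          (∑ j, ∏ i, if i = j then (Y + s • v) (Sum.inr i) else (Y + s • v) (Sum.inl i)) -
          4 * ∏ i, (Y + s • v) (Sum.inl i) * (Y + s • v) (Sum.inr i) = 0 :=
      fun s => sub_eq_zero.2 (hdisc _ (hm s))
    have P0 := P 0
    have P1 := P 1
    have P2 := P 2
    have P3 := P 3
    obtain ⟨e0l, e00, e01, e02, e03⟩ := ev 0
    obtain ⟨e1l, e10, e11, e12, e13⟩ := ev 1
    obtain ⟨e2l, e20, e21, e22, e23⟩ := ev 2
    obtain ⟨e3l, e30, e31, e32, e33⟩ := ev 3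
    rw [sumA_four, sumA_four, prodAB_four] at P0 P1 P2 P3
    simp only [e0l, e00, e01, e02, e03] at P0
    simp only [e1l, e10, e11, e12, e13] at P1
    simp only [e2l, e20, e21, e22, e23] at P2
    simp only [e3l, e30, e31, e32, e33] at P3
    -- third finite difference `P3 - 3 P2 + 3 P1 - P0 = 6 · c₃`
    have h6 : (6 : K) * ((Y (Sum.inl 0) * Y (Sum.inr 1) + Y (Sum.inl 1) * Y (Sum.inr 0)) *
        (Y (Sum.inl 0) * Y (Sum.inl 1)) * (Y (Sum.inl 2) + Y (Sum.inl 3))) = 0 := by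
      linear_combination P3 - 3 * P2 + 3 * P1 - P0
    exact (mul_eq_zero.1 h6).resolve_left (by norm_num)
  -- (b) `q ≡ 0` on `V'`
  have hq : ∀ Y ∈ V', Y (Sum.inl 0) * Y (Sum.inr 1) + Y (Sum.inl 1) * Y (Sum.inr 0) = 0 := by
    rcases forall_eq_zero_or_of_mul₃ V'
        (f := fun Z : Fin 4 ⊕ Fin 4 → K => Z (Sum.inl 0) * Z (Sum.inr 1) + Z (Sum.inl 1) * Z (Sum.inr 0))
        (g := fun Z : Fin 4 ⊕ Fin 4 → K => Z (Sum.inl 0) * Z (Sum.inl 1))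
        (h := fun Z : Fin 4 ⊕ Fin 4 → K => Z (Sum.inl 2) + Z (Sum.inl 3))
        linePoly_q linePoly_a01 linePoly_a23 hcubic with hf | hg | hh
    · exact hf
    · exfalso
      have := hg Y₁ hY₁
      simp [hY₁a] at this
    · exfalso
      have := hh Y₁ hY₁
      norm_num [hY₁a] at this
  -- (c) the quadratic along `e_{β₂}`: `α₀α₁α₃(α₃β₀β₁ + β₃ q) ≡ 0`, hence `α₀α₁α₃²β₀β₁ ≡ 0`
  have hsix : ∀ Y ∈ V', Y (Sum.inl 0) * Y (Sum.inl 1) * Y (Sum.inl 3) * Y (Sum.inl 3) *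
      Y (Sum.inr 0) * Y (Sum.inr 1) = 0 := by
    intro Y hY
    set v : Fin 4 ⊕ Fin 4 → K := Pi.single (Sum.inr 2) 1 with hv
    have hm : ∀ s : K, Y + s • v ∈ V' := fun s => V'.add_mem hY (V'.smul_mem s h2)
    have ev : ∀ s : K, (∀ i, (Y + s • v) (Sum.inl i) = Y (Sum.inl i)) ∧
        (Y + s • v) (Sum.inr 0) = Y (Sum.inr 0) ∧ (Y + s • v) (Sum.inr 1) = Y (Sum.inr 1) ∧
        (Y + s • v) (Sum.inr 2) = Y (Sum.inr 2) + s ∧ (Y + s • v) (Sum.inr 3) = Y (Sum.inr 3) := by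
      intro s
      refine ⟨fun i => ?_, ?_, ?_, ?_, ?_⟩ <;> simp [hv]
    have P : ∀ s : K,
        (∑ j, ∏ i, if i = j then (Y + s • v) (Sum.inl i) else (Y + s • v) (Sum.inr i)) *
          (∑ j, ∏ i, if i = j then (Y + s • v) (Sum.inr i) else (Y + s • v) (Sum.inl i)) -
          4 * ∏ i, (Y + s • v) (Sum.inl i) * (Y + s • v) (Sum.inr i) = 0 :=
      fun s => sub_eq_zero.2 (hdisc _ (hm s))
    have P0 := P 0
    have P1 := P 1
    have P2 := P 2
    obtain ⟨e0l, e00, e01, e02, e03⟩ := ev 0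
    obtain ⟨e1l, e10, e11, e12, e13⟩ := ev 1
    obtain ⟨e2l, e20, e21, e22, e23⟩ := ev 2
    rw [sumA_four, sumA_four, prodAB_four] at P0 P1 P2
    simp only [e0l, e00, e01, e02, e03] at P0
    simp only [e1l, e10, e11, e12, e13] at P1
    simp only [e2l, e20, e21, e22, e23] at P2
    have hqY := hq Y hY
    -- second difference `P2 - 2 P1 + P0 = 2 · c₂`, and `q(Y) = 0`
    have h2c : (2 : K) * (Y (Sum.inl 0) * Y (Sum.inl 1) * Y (Sum.inl 3) * Y (Sum.inl 3) *
        Y (Sum.inr 0) * Y (Sum.inr 1)) = 0 := by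
      linear_combination P2 - 2 * P1 + P0 -
        2 * (Y (Sum.inl 0) * Y (Sum.inl 1) * Y (Sum.inl 3) * Y (Sum.inr 3)) * hqY
    exact (mul_eq_zero.1 h2c).resolve_left two_ne_zero
  -- one of the six coordinate factors vanishes identically: it must be `β₀` or `β₁`
  let f : Fin 6 → ((Fin 4 ⊕ Fin 4 → K) →ₗ[K] K) :=
    ![LinearMap.proj (Sum.inl 0), LinearMap.proj (Sum.inl 1), LinearMap.proj (Sum.inl 3),
      LinearMap.proj (Sum.inl 3), LinearMap.proj (Sum.inr 0), LinearMap.proj (Sum.inr 1)]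
  have hprod : ∀ Y ∈ V', ∏ t ∈ (Finset.univ : Finset (Fin 6)), f t Y = 0 := by
    intro Y hY
    rw [Fin.prod_univ_six]
    simpa [f] using hsix Y hY
  obtain ⟨t, -, ht⟩ := exists_forall_eq_zero_of_prod_eq_zero V' f Finset.univ hprod
  have hα : ∀ i : Fin 4, ¬ (∀ Y ∈ V', Y (Sum.inl i) = 0) := fun i h => by
    have := h Y₁ hY₁
    rw [hY₁a] at this
    exact one_ne_zero this
  -- `β₀ ≡ 0` or `β₁ ≡ 0`
  have hβ : (∀ Y ∈ V', Y (Sum.inr 0) = 0) ∨ (∀ Y ∈ V', Y (Sum.inr 1) = 0) := by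
    fin_cases t
    · exact absurd (fun Y hY => by simpa [f] using ht Y hY) (hα 0)
    · exact absurd (fun Y hY => by simpa [f] using ht Y hY) (hα 1)
    · exact absurd (fun Y hY => by simpa [f] using ht Y hY) (hα 3)
    · exact absurd (fun Y hY => by simpa [f] using ht Y hY) (hα 3)
    · exact Or.inl fun Y hY => by simpa [f] using ht Y hY
    · exact Or.inr fun Y hY => by simpa [f] using ht Y hY
  -- (d) the other one from `q ≡ 0`
  rcases hβ with h0 | h1
  · -- `β₀ ≡ 0`, so `α₀ β₁ ≡ 0`, and `α₀ ≢ 0`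
    have hprod' : ∀ Y ∈ V', ∏ t ∈ (Finset.univ : Finset (Fin 2)),
        (![LinearMap.proj (Sum.inl 0), LinearMap.proj (Sum.inr 1)] :
          Fin 2 → ((Fin 4 ⊕ Fin 4 → K) →ₗ[K] K)) t Y = 0 := by
      intro Y hY
      have := hq Y hY
      rw [h0 Y hY, mul_zero, add_zero] at this
      rw [Fin.prod_univ_two]
      simpa using this
    obtain ⟨t', -, ht'⟩ := exists_forall_eq_zero_of_prod_eq_zero V' _ Finset.univ hprod'
    fin_cases t'
    · exact absurd (fun Y hY => by simpa using ht' Y hY) (hα 0)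
    · exact fun Y hY => ⟨h0 Y hY, by simpa using ht' Y hY⟩
  · have hprod' : ∀ Y ∈ V', ∏ t ∈ (Finset.univ : Finset (Fin 2)),
        (![LinearMap.proj (Sum.inl 1), LinearMap.proj (Sum.inr 0)] :
          Fin 2 → ((Fin 4 ⊕ Fin 4 → K) →ₗ[K] K)) t Y = 0 := by
      intro Y hY
      have := hq Y hY
      rw [h1 Y hY, mul_zero, zero_add] at this
      rw [Fin.prod_univ_two]
      simpa using this
    obtain ⟨t', -, ht'⟩ := exists_forall_eq_zero_of_prod_eq_zero V' _ Finset.univ hprod'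
    fin_cases t'
    · exact absurd (fun Y hY => by simpa using ht' Y hY) (hα 1)
    · exact fun Y hY => ⟨by simpa using ht' Y hY, h1 Y hY⟩

end Summit.ValiantsHypothesis.ValiantsHypothesis.Theorems.SymPencilPerFourPairingDiscSixNormal

end
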